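import Mathlib.RingTheory.KrullDimension.NonZeroDivisors
import Literature.NumberTheory.Automorphic.ZariskiGL
import HarnessLib

/-!
# Dimension of connected algebraic subgroups of `GL n k` (Springer 1.8.1–1.8.2)
(trunk T-AUTOMORPHIC, G25 AutomorphicL)

Companion to `ZariskiGL.lean` (namespace `Literature.Automorphic`), which attaches to a Zariski-connected
algebraic subgroup `H ≤ GL n k` the prime `hH.primePoint = 𝓘(H) ∈ Spec k[x_{ij}, det⁻¹]` and its
(finite) height `hH.primeHeight`. Here the complementary invariant:

* `IsZConnected.zdim hH : ℕ` — the **dimension** of `H`: the Krull dimension of its coordinate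
  ring `k[H] = k[x_{ij}, y]/𝓘(H)`, i.e. the coheight of `𝓘(H)` in `Spec k[x_{ij}, y]` (Mathlib
  `Order.coheight`), finite because `dim k[x_{ij}, y] = n² + 1`. For `k` algebraically closed this
  is the dimension of the irreducible affine variety `H` (Springer 1.8.1 defines `dim` as the
  transcendence degree of `k(H)`, which is the Krull dimension of `k[H]`);
* `IsZConnected.zdim_lt_of_lt` — **Springer 1.8.2 for connected algebraic subgroups**: a proper
  connected algebraic subgroup has strictly smaller dimension; `IsZConnected.eq_of_le_of_zdim_eq`;
* `IsZConnected.coe_zdim_eq_ringKrullDim_quotient` — `zdim H` is the Krull dimension of the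
  quotient ring `k[x_{ij}, y] / 𝓘(H)` (the form of `Literature.NumberTheory.Transcendental.zariskiDim` in
  `Literature/NumberTheory/Transcendental/ExpVarieties.lean`).

## References

* T. A. Springer, *Linear Algebraic Groups*, 2nd ed., Progress in Mathematics 9, Birkhäuser
  (1998), 1.8.1–1.8.2, 2.2.1.
-/

namespace Literature.NumberTheory.Automorphic

variable {k : Type*} [Field k] {n : Type*} [Fintype n] [DecidableEq n]
variable {H H' : Subgroup (GL n k)}

/-- The coheight of the prime `𝓘(H)` of a connected algebraic subgroup is finite (at most
`n² + 1 = dim k[x_{ij}, y]`). [folklore] -/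
theorem IsZConnected.coheight_primePoint_lt_top (hH : IsZConnected H) :
    Order.coheight hH.primePoint < ⊤ := by
  have h1 := Order.coheight_le_krullDim hH.primePoint
  have h2 : Order.krullDim (PrimeSpectrum (MvPolynomial (GLCoord n) k)) =
      (Nat.card (GLCoord n) : WithBot ℕ∞) := ringKrullDim_mvPolynomial_glCoord
  rw [h2] at h1
  have h3 : Order.coheight hH.primePoint ≤ (Nat.card (GLCoord n) : ℕ∞) := by exact_mod_cast h1
  exact lt_of_le_of_lt h3 (ENat.coe_lt_top _)

/-- The **dimension** of a connected algebraic subgroup `H ≤ GL n k`: the Krull dimension of its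
coordinate ring `k[x_{ij}, y]/𝓘(H)`, i.e. the coheight of the prime `𝓘(H)` in
`Spec k[x_{ij}, y]` (Springer 1.8.1: for `k` algebraically closed, the dimension of the
irreducible affine variety `H`). [folklore] -/
noncomputable def IsZConnected.zdim (hH : IsZConnected H) : ℕ :=
  (Order.coheight hH.primePoint).toNat

/-- `zdim` as an extended natural number is the coheight of `𝓘(H)`. [folklore] -/
theorem IsZConnected.coe_zdim (hH : IsZConnected H) :
    (hH.zdim : ℕ∞) = Order.coheight hH.primePoint :=
  ENat.coe_toNat hH.coheight_primePoint_lt_top.ne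

/-- The dimension is at most `n² + 1`. [folklore] -/
theorem IsZConnected.zdim_le (hH : IsZConnected H) : hH.zdim ≤ Nat.card (GLCoord n) := by
  have h1 := Order.coheight_le_krullDim hH.primePoint
  have h2 : Order.krullDim (PrimeSpectrum (MvPolynomial (GLCoord n) k)) =
      (Nat.card (GLCoord n) : WithBot ℕ∞) := ringKrullDim_mvPolynomial_glCoord
  rw [h2, ← hH.coe_zdim] at h1
  exact_mod_cast h1

/-- **Springer 1.8.2 for connected algebraic subgroups: strictly larger connected algebraic
subgroups have strictly larger dimension** (the vanishing ideal strictly decreases, and coheight is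
strictly antitone on primes of finite coheight). [cite: SpringerLAG1998, Prop 1.8.2] -/
theorem IsZConnected.zdim_lt_of_lt (hH : IsZConnected H) (hH' : IsZConnected H') (hlt : H < H') :
    hH.zdim < hH'.zdim := by
  have hpt : hH'.primePoint < hH.primePoint := hH.primePoint_lt_of_lt hH' hlt
  have h := Order.coheight_strictAnti hpt hH.coheight_primePoint_lt_top
  rw [← hH.coe_zdim, ← hH'.coe_zdim] at h
  exact_mod_cast h

/-- Connected algebraic subgroups `H ≤ H'` of the same dimension are equal (Springer 1.8.2).
[cite: SpringerLAG1998, Prop 1.8.2] -/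
theorem IsZConnected.eq_of_le_of_zdim_eq (hH : IsZConnected H) (hH' : IsZConnected H')
    (hle : H ≤ H') (hdim : hH.zdim = hH'.zdim) : H = H' := by
  by_contra hne
  have := hH.zdim_lt_of_lt hH' (lt_of_le_of_ne hle hne)
  omega

/-- **The dimension is the Krull dimension of the coordinate ring**:
`zdim H = dim (k[x_{ij}, y] / 𝓘(H))` (Mathlib `ringKrullDim_quotient`: `dim (R/𝔭) = krullDim V(𝔭)`,
and `V(𝔭) = Ici 𝔭` in `Spec R` ordered by inclusion, whose Krull dimension is the coheight of `𝔭`,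
`Order.coheight_eq_krullDim_Ici`). This is the form of the sibling notion `Literature.NumberTheory.Transcendental.zariskiDim` of
`Literature/NumberTheory/Transcendental/ExpVarieties.lean` (`ringKrullDim` of
`K[X_ι] ⧸ vanishingIdeal`), here for `S = glCoordFun '' H`. [folklore] -/
theorem IsZConnected.coe_zdim_eq_ringKrullDim_quotient (hH : IsZConnected H) :
    ((hH.zdim : ℕ∞) : WithBot ℕ∞) =
      ringKrullDim (MvPolynomial (GLCoord n) k ⧸
        MvPolynomial.vanishingIdeal k (glCoordFun '' (H : Set (GL n k)))) := by
  rw [hH.coe_zdim, Order.coheight_eq_krullDim_Ici, ringKrullDim_quotient]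
  -- `V(𝓘(H)) = Ici (primePoint)` as ordered sets
  have hset : PrimeSpectrum.zeroLocus (R := MvPolynomial (GLCoord n) k)
      ↑(MvPolynomial.vanishingIdeal k (glCoordFun '' (H : Set (GL n k)))) =
      Set.Ici hH.primePoint := by
    ext q
    rw [PrimeSpectrum.mem_zeroLocus, Set.mem_Ici, ← PrimeSpectrum.asIdeal_le_asIdeal,
      IsZConnected.primePoint_asIdeal]
    rfl
  rw [hset]

end Literature.NumberTheory.Automorphic
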